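import Mathlib
import Summits.Schanuel.Schanuel.Theses.RelationCounting

/-!
# Birth skeleton (BC3) — crux `RelationCounting.CountingGapHigher` (stmt-Schanuel-16237)

Route `route-Schanuel-RelationCounting` (relation counting on the exponential leaf), crux of rank 2:

  `CountingGapHigher := ∀ k ≥ 2, ∀ b > 0, ∃ M ≥ k + 2, ∃ κ < (M − k − 1)·k, ∃ C, ∀ᶠ T → ∞,
      encard S(k, M, b, T) ≤ ⌊C · T^κ⌋`,

where the COUNTED SET `S(k, M, b, T) ⊆ ℂ^M` (the set literal of the crux, abbreviated `counted k M b T`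
below) consists of the `w` with `|Re wᵢ| ≤ T`, `|Im wᵢ| ≤ b`, some `k + 1` coordinates `ℚ`-linearly
independent, and `s ≥ 2M − k` integer relations of degree `≤ T` and coefficients `≤ T` vanishing at
`(w, e^w)` with `ℂ`-independent gradients, `M` of them a non-degenerate Khovanskii system.  Every counted
point is a Schanuel counterexample (refuter route-review 2026-08-16), the width amplification of ONE first
failure of rank `k + 1` puts `≍ T^((M−k−1)k)` points into `S(k, M, b, T)` (route item `Amplification`),
and the crux asks for strictly fewer.

This file is the route-level BIRTH CERTIFICATE skeleton of the crux (LENSES-v3 §2 BC3; registrar seat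
`planner-skel-stmt-Schanuel-16237-0`, 2026-08-17, route re-audit bin REPAIRABLE): TWO NAMED STUBS and a
kernel-checked composition `CountingGapHigher_of : stub₁-sig → stub₂-sig → CountingGapHigher` concluding
the crux BY NAME.  `sorry` occurs ONLY in the two `stub_*` theorems.

## The seam: CLUSTER × PER-CELL — the route's own two-layer plan, = BHKK's Conj. 3 / Conj. 1 split

Tile the strip box by UNIT CELLS `cell(n) = {w : ⌊Re wᵢ⌋ = nᵢ ∀ i}`, `n ∈ ℤ^M` (each a compact box
`∏ [nᵢ, nᵢ + 1] × [−b, b]`, on which `(w, e^w)` ranges over a COMPACT piece of the leaf `Γ_M = {(w, e^w)}`,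
definable in `ℝ_an` — restricted `exp`, `sin`, `cos` — and the cells form ONE definable family with real
parameter `e^n ∈ (0, ∞)^M`).  Then `encard S ≤ #{cells met} · max_n #(S ∩ cell n)` (fibre counting over
the cell map `w ↦ ⌊Re w⌋`, `encard_le_mul_of_fibres`), and the amplification threshold `(M − k − 1)·k`
splits as `(M − k − 1) + (M − k − 1)(k − 1)` — exactly the two statistics SATURATED by the amplified family
of one generic first failure `z` (`z` fixed ⇒ its `M − k − 1` free rows `K_r · z`, `|Re| ≤ T`, meet
`≍ T^(M−k−1)` cells; the strip condition `|Im K_r · z| ≤ b` and a unit `Re`-window leave `≍ T^(k−1)` rows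
per cell, `≍ T^((M−k−1)(k−1))` points per cell).  This is the split Binyamini–Hirata-Kohno–Kawashima–Salant
make of their own relation-counting conjecture (arXiv:2604.15189 p. 4): Conjecture 3 (the relation points
lie in `poly(g, h)` balls) is the benchmark "existing techniques in algebraic independence theory seem to be
more suitable for", Conjecture 1 (a `poly(g, h)` count) "appears to be far more challenging"; the route
header files the same split as its TWO-LAYER PLAN `CountingGapHigher ⇐ UnitCellCluster → PerCellGap`
(`κ₁ + κ₂ < (M − k − 1)k`), and this skeleton registers it with the exponent budget cut at the saturation
point:

* `stub_unitCellCluster` — `UnitCellCluster`, the STRUCTURAL piece (growth in the non-compact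
  `Re`-directions): for EVERY width `M ≥ k + 2`, the counted points at complexity `T` meet at most
  `C · T^(M−k−1)` unit cells — Conj. 3 made arithmetic at unit radius on the leaf.  Consistent with every
  single amplified family (generic `z`: `≍ T^(M−k−1)` cells; `z` on a non-real ray: `O(1)` cells; real `z`:
  `≍ T^(M−k−1)`), so its content is the distribution over cells of DIFFERENT first failures and
  presentations; trivial bound `(2T + 3)^M`.  Why it might fail / size: under `¬SC` at level `k` with
  `≫ T^ε` essentially different first failures of complexity `≤ T` it is false; no technique locates the
  cells of Schanuel counterexamples; SC-hard (vacuous under SC), M-to-L as a counting statement.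
* `stub_perCellGap` — `PerCellGap`, the DECIDING piece (relation counting on one compact piece, uniformly
  in the piece): for SOME width `M ≥ k + 2` and SOME `κ < (M − k − 1)(k − 1)`, every unit cell holds at most
  `C · T^κ` counted points of complexity `T`, for all large `T` — Conj. 1 in its native compact / restricted
  setting, degree aspect, with a power saving below the per-cell density of one amplified family.  Why it
  might fail / size: it is violated by the amplified family of ANY first failure of rank `k + 1` (so, with a
  per-cell amplification lemma — elementary but not filed — it decides Schanuel at level `k` on its own,
  exactly as the crux does with `Amplification`); known degree-aspect counting (Binyamini–Novikov–Zak) has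
  exponents polynomial in the format, here it must be governed by the deficit `k`; open-problem-sized.

NEITHER STUB GIVES THE CRUX ALONE: `stub_perCellGap` with the trivial cell count `(2T + 3)^M` reaches
exponent `M + κ`, and `M + κ < (M − k − 1)k` would need `κ < (M − k − 1)(k − 1) − (k + 1)` — the stub's
budget is `k + 1` too generous, which is precisely what `stub_unitCellCluster` pays for; and
`stub_unitCellCluster` says nothing about one cell.  Neither stub is a consequence of the crux as typed
(the crux bounds the total with an exponent `< (M − k − 1)k` at ONE width; stub 1 wants `M − k − 1` at EVERY
width, stub 2 wants `< (M − k − 1)(k − 1)` per cell); both, like the crux, are consequences of SC (the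
counted sets are empty) and irrefutable short of `¬SC`.

* `CountingGapHigher_of : stub₁-sig → stub₂-sig → RelationCounting.CountingGapHigher` — SORRY-FREE
  composition (axioms `propext`, `Classical.choice`, `Quot.sound`): `PerCellGap` supplies `M`, `κ`, `C₂`;
  `UnitCellCluster` at that `M` supplies `C₁`; fibre counting (`Finset.card_le_mul_card_image`) and
  `⌊C₁T^a⌋ · ⌊C₂T^κ⌋ ≤ ⌊C₁⁺C₂⁺ · T^(a+κ)⌋` (`floor_mul_floor_le`) give the crux with exponent
  `(M − k − 1) + κ < (M − k − 1)k` (`exponent_lt`) and constant `max C₁ 0 · max C₂ 0`.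
* `CountingGapHigher_proof : CountingGapHigher` — the skeleton in its final shape (the crux BY NAME from the
  two registered stubs; depends on `sorryAx` through the stubs only).

## Disproof used / negatives / dead lines

None exist: `ledger crux ls stmt-Schanuel-16237` (2026-08-17) — no workfiles, no `Disproof.lean`, no
`_false_without_` theorem, no crux ideas, no lines, no landed `Theorems/CountingGapHigher/Negative/*`.
`ledger negatives --problem Schanuel`: 2 refuted statements, both the PolarPhantoms `trdeg < n` target/crux
(stmt-Schanuel-6844/6846) — unrelated to either stub (no `encard`, no counting).  The route's recorded
KILL CRITERION (i) (if the presentation clauses do not force `trdeg ℚ(w, e^w) ≤ k`, generic swarms make the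
cruxes false) applies to both stubs verbatim — they count subsets / cell-images of the same counted set.

## BC3 audit (this seat; raw outputs under `birth-certificate:` in the seat's NOTES.md and `Lines/birth.md`)

`lean check --json` rc 0, errors [], `sorry` exactly in `stub_unitCellCluster`, `stub_perCellGap` (sorry
count 2 = stub count, zero elsewhere); `#print axioms CountingGapHigher_of` = [propext, Classical.choice,
Quot.sound].  Probes (seat files `bc/probe_{ucc,pcg}_{crux,summit}.lean`, importing ONLY `Mathlib` and the
route file — never this file — with the stub signatures restated verbatim as `abbrev StubUCC / StubPCG`,
`maxHeartbeats 400000` per example, one tactic per example): for `X ∈ {StubUCC, StubPCG}` and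
`T ∈ {CountingGapHigher, Schanuel}` the eight examples `X → T` by `first | exact? | simpa | aesop` ·
`exact?` · `simpa` · `simpa [X, T]` · `unfold X T; simpa` · `aesop`, and `(h : X) : T` by `simpa using h` ·
`exact?` — 32/32 FAIL (rc 1 each file; `exact?`: "could not close the goal"; `simpa`: "assumption failed" /
"type mismatch"; `aesop`: "failed to prove the goal after exhaustive search").  No stub is cheaply the
crux or the summit.

## References

* G. Binyamini, N. Hirata-Kohno, M. Kawashima, N. Salant, *Counting theorems for algebraic relations*,
  arXiv:2604.15189 (2026), Conjecture 1, Theorem 2, Conjecture 3 (pp. 3–4). [BinyaminiEtAl2026]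
* J. Pila, *On the algebraic points of a definable set*, Ann. Inst. Fourier 60 (2010),
  doi:10.5802/aif.2530, pp. 490–494. [Pila2010]
* G. Binyamini, D. Novikov, B. Zak, *Wilkie's conjecture for Pfaffian structures*, Ann. of Math. (2024).
  [BinyaminiNovikovZak2024]
* J. Pila, A. Wilkie, *The rational points of a definable set*, Duke Math. J. 133 (2006). [PilaWilkie2006]
* E. Bombieri, J. Pila, *The number of integral points on arcs and ovals*, Duke Math. J. 59 (1989).
  [BombieriPila1989]
* S. Lang, *Introduction to transcendental numbers* (1966), pp. 30–31. [Lang1966]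
-/

set_option linter.dupNamespace false
set_option linter.unusedVariables false

noncomputable section

namespace Summit.Schanuel.Schanuel.Cruxes.CountingGapHigher.Birth

open Summit.Schanuel.Schanuel.Theses.RelationCounting

/-! ## The counted set and the unit cells (abbreviations used only in the proofs) -/

/-- The COUNTED SET `S(k, M, b, T) ⊆ ℂ^M` of the crux — verbatim the set literal of
`RelationCounting.CountingGapHigher` (level `k`, width `M`, strip height `b`, complexity `T`). -/
def counted (k M : ℕ) (b T : ℝ) : Set (Fin M → ℂ) :=
  {w : Fin M → ℂ | (∀ i, |(w i).re| ≤ T ∧ |(w i).im| ≤ b) ∧ (∃ f : Fin (k + 1) ↪ Fin M, LinearIndependent ℚ (w ∘ f)) ∧ ∃ (s : ℕ) (P : Fin s → MvPolynomial (Fin M ⊕ Fin M) ℤ) (e : Fin M ↪ Fin s), 2 * M ≤ s + k ∧ (∀ j, ((P j).totalDegree : ℝ) ≤ T ∧ ∀ mo, |(((P j).coeff mo : ℤ) : ℝ)| ≤ T) ∧ (∀ j, MvPolynomial.aeval (Sum.elim w (Complex.exp ∘ w)) (P j) = 0) ∧ LinearIndependent ℂ (fun j => fun i : Fin M ⊕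 Fin M => MvPolynomial.aeval (Sum.elim w (Complex.exp ∘ w)) (MvPolynomial.pderiv i (P j))) ∧ (Matrix.of fun i j : Fin M => MvPolynomial.aeval (Sum.elim w (Complex.exp ∘ w)) (MvPolynomial.pderiv (Sum.inl j) (P (e i)) + MvPolynomial.X (Sum.inr j) * MvPolynomial.pderiv (Sum.inr j) (P (e i)))).det ≠ 0}

/-- The UNIT CELL of `w ∈ ℂ^M`: the integer parts of the real parts of its coordinates. -/
def cellOf {M : ℕ} (w : Fin M → ℂ) : Fin M → ℤ := fun i => ⌊(w i).re⌋

/-! ## The two registered stubs (the only `sorry`s of this file) -/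

/-- **Stub 1 — `UnitCellCluster` (growth control in the non-compact `Re`-directions).**
For every level `k ≥ 2`, strip height `b > 0` and EVERY width `M ≥ k + 2` there is `C` such that for
all large `T` the counted points of `ℂ^M` at complexity `T` meet at most `C · T^(M − k − 1)` unit cells
`{w : ⌊Re wᵢ⌋ = nᵢ}` (`n ∈ ℤ^M`) — against the trivial `(2T + 2)^M`.  The exponent `M − k − 1` is the
one SATURATED by the width amplification of a single first failure (`z` fixed, `M − k − 1` free rows
`K_r · z` with `|Re| ≤ T`), so the stub asks that the counted points be no more spread out over cells
than one amplified family.  BinyaminiEtAl2026 (arXiv:2604.15189) Conj. 3, made arithmetic at unit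
radius, on the exponential leaf. -/
theorem stub_unitCellCluster :
    ∀ k : ℕ, 2 ≤ k → ∀ b : ℝ, 0 < b → ∀ M : ℕ, k + 2 ≤ M → ∃ C : ℝ, ∀ᶠ T : ℝ in Filter.atTop,
      ({n : Fin M → ℤ | ∃ w : Fin M → ℂ, ((∀ i, |(w i).re| ≤ T ∧ |(w i).im| ≤ b) ∧ (∃ f : Fin (k + 1) ↪ Fin M, LinearIndependent ℚ (w ∘ f)) ∧ ∃ (s : ℕ) (P : Fin s → MvPolynomial (Fin M ⊕ Fin M) ℤ) (e : Fin M ↪ Fin s), 2 * M ≤ s + k ∧ (∀ j, ((P j).totalDegree : ℝ) ≤ T ∧ ∀ mo, |(((P j).coeff mo : ℤ) : ℝ)| ≤ T) ∧ (∀ j, MvPolynomial.aeval (Sum.elim w (Complex.exp ∘ w)) (P j) = 0) ∧ LinearIndependent ℂ (fun j => fun i : Fin M ⊕ Fin M => MvPolynomial.aeval (Sum.elim w (Complex.exp ∘ w)) (MvPolynomial.pderiv i (P j))) ∧ (Matrix.of fun i j : Fin M => MvPolynomial.aeval (Sum.elim w (Complex.exp ∘ w)) (MvPolynomial.pderiv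 (Sum.inl j) (P (e i)) + MvPolynomial.X (Sum.inr j) * MvPolynomial.pderiv (Sum.inr j) (P (e i)))).det ≠ 0) ∧ ∀ i, ⌊(w i).re⌋ = n i}).encard
        ≤ ((⌊C * T ^ ((M : ℝ) - k - 1)⌋₊ : ℕ) : ℕ∞) := by
  sorry

/-- **Stub 2 — `PerCellGap` (relation counting on ONE compact piece of the leaf, uniformly in the piece).**
For every level `k ≥ 2` and strip height `b > 0` there are a width `M ≥ k + 2`, an exponent
`κ < (M − k − 1)(k − 1)` and `C` such that for all large `T` EVERY unit cell `{w : ⌊Re wᵢ⌋ = nᵢ}` of the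
strip box holds at most `C · T^κ` counted points of complexity `T`.  On a cell, `(w, e^w)` ranges over a
COMPACT piece of the leaf `Γ_M`, definable in `ℝ_an` (restricted `exp`), and the cells form a definable
family (parameter `e^n ∈ (0, ∞)^M`): this is BinyaminiEtAl2026 (arXiv:2604.15189) Conj. 1 in its native
compact setting, degree aspect, with the exponent strictly below the per-cell density
`(M − k − 1)(k − 1)` of one amplified family — the piece that decides. -/
theorem stub_perCellGap :
    ∀ k : ℕ, 2 ≤ k → ∀ b : ℝ, 0 < b → ∃ M : ℕ, k + 2 ≤ M ∧ ∃ κ : ℝ, κ < ((M : ℝ) - k - 1) * ((k : ℝ) - 1) ∧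
      ∃ C : ℝ, ∀ᶠ T : ℝ in Filter.atTop, ∀ n : Fin M → ℤ,
        ({w : Fin M → ℂ | ((∀ i, |(w i).re| ≤ T ∧ |(w i).im| ≤ b) ∧ (∃ f : Fin (k + 1) ↪ Fin M, LinearIndependent ℚ (w ∘ f)) ∧ ∃ (s : ℕ) (P : Fin s → MvPolynomial (Fin M ⊕ Fin M) ℤ) (e : Fin M ↪ Fin s), 2 * M ≤ s + k ∧ (∀ j, ((P j).totalDegree : ℝ) ≤ T ∧ ∀ mo, |(((P j).coeff mo : ℤ) : ℝ)| ≤ T) ∧ (∀ j, MvPolynomial.aeval (Sum.elim w (Complex.exp ∘ w)) (P j) = 0) ∧ LinearIndependent ℂ (fun j => fun i : Fin M ⊕ Fin M => MvPolynomial.aeval (Sum.elim w (Complex.exp ∘ w)) (MvPolynomial.pderiv i (P j))) ∧ (Matrix.of fun i j : Fin M => MvPolynomial.aeval (Sum.elim w (Complex.exp ∘ w)) (MvPolynomial.pderiv (Sum.inl j) (P (e i)) + MvPolynomial.X (Sum.inr j) * MvPolynomial.pderiv (Sum.inr j) (P (e i)))).det ≠ 0) ∧ ∀ i, ⌊(w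 i).re⌋ = n i}).encard
          ≤ ((⌊C * T ^ κ⌋₊ : ℕ) : ℕ∞) := by
  sorry

/-! ## Sorry-free lemmas of the seam -/

/-- **Fibre counting.** If the image `f '' S` has at most `N₁` elements and every fibre of `f` on `S`
at most `N₂`, then `S` has at most `N₁ · N₂` elements (in `ℕ∞`, so finiteness is a conclusion,
not a hypothesis). [folklore] -/
theorem encard_le_mul_of_fibres {α β : Type*} (S : Set α) (f : α → β) (N₁ N₂ : ℕ)
    (h₁ : (f '' S).encard ≤ N₁) (h₂ : ∀ y, {x ∈ S | f x = y}.encard ≤ N₂) :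
    S.encard ≤ (N₁ : ℕ∞) * N₂ := by
  classical
  have hfin₁ : (f '' S).Finite := Set.finite_of_encard_le_coe h₁
  have hfinS : S.Finite := by
    have hsub : S ⊆ ⋃ y ∈ f '' S, {x ∈ S | f x = y} := by
      intro x hx
      simp only [Set.mem_iUnion, Set.mem_setOf_eq, exists_prop]
      exact ⟨f x, ⟨x, hx, rfl⟩, hx, rfl⟩
    exact (hfin₁.biUnion fun y _ => Set.finite_of_encard_le_coe (h₂ y)).subset hsub
  set s : Finset α := hfinS.toFinset with hs
  have hS : S.encard = (s.card : ℕ∞) := hfinS.encard_eq_coe_toFinset_card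
  have himg : ((s.image f).card : ℕ∞) ≤ N₁ := by
    have e : f '' S = ((s.image f : Finset β) : Set β) := by
      rw [Finset.coe_image, Set.Finite.coe_toFinset]
    rw [← Set.encard_coe_eq_coe_finsetCard, ← e]
    exact h₁
  have hfib : ∀ y ∈ s.image f, (s.filter fun x => f x = y).card ≤ N₂ := by
    intro y _
    have e : {x ∈ S | f x = y} = ((s.filter fun x => f x = y : Finset α) : Set α) := by
      ext x
      simp [hs]
    have h := h₂ y
    rw [e, Set.encard_coe_eq_coe_finsetCard] at h
    exact_mod_cast h
  have hmul : s.card ≤ N₂ * (s.image f).card := Finset.card_le_mul_card_image s N₂ hfib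
  calc S.encard = (s.card : ℕ∞) := hS
    _ ≤ ((N₂ * (s.image f).card : ℕ) : ℕ∞) := by exact_mod_cast hmul
    _ = (N₂ : ℕ∞) * ((s.image f).card : ℕ∞) := by push_cast; rfl
    _ ≤ (N₂ : ℕ∞) * N₁ := by gcongr
    _ = (N₁ : ℕ∞) * N₂ := mul_comm _ _

/-- The cells met by `S` are the image of `S` under `cellOf`. [folklore] -/
theorem image_cellOf_eq {M : ℕ} (S : Set (Fin M → ℂ)) :
    cellOf '' S = {n : Fin M → ℤ | ∃ w ∈ S, ∀ i, ⌊(w i).re⌋ = n i} := by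
  ext n
  simp only [Set.mem_image, Set.mem_setOf_eq, cellOf, funext_iff]

/-- The counted points in the cell `n` are the fibre of `cellOf` over `n`. [folklore] -/
theorem fibre_cellOf_eq {M : ℕ} (S : Set (Fin M → ℂ)) (n : Fin M → ℤ) :
    {w ∈ S | cellOf w = n} = {w ∈ S | ∀ i, ⌊(w i).re⌋ = n i} := by
  ext w
  simp only [Set.mem_setOf_eq, cellOf, funext_iff]

/-- **Floor arithmetic of the union bound**: `⌊C₁ T^a⌋ · ⌊C₂ T^κ⌋ ≤ ⌊(C₁⁺ C₂⁺) T^(a+κ)⌋` for `T > 0`,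
with `C⁺ = max C 0`. [folklore] -/
theorem floor_mul_floor_le {C₁ C₂ T a κ : ℝ} (hT : 0 < T) :
    ⌊C₁ * T ^ a⌋₊ * ⌊C₂ * T ^ κ⌋₊ ≤ ⌊(max C₁ 0 * max C₂ 0) * T ^ (a + κ)⌋₊ := by
  have ha : 0 < T ^ a := Real.rpow_pos_of_pos hT a
  have hκ : 0 < T ^ κ := Real.rpow_pos_of_pos hT κ
  have bound : ∀ (C x : ℝ), 0 < x → (⌊C * x⌋₊ : ℝ) ≤ max C 0 * x := by
    intro C x hx
    rcases le_or_gt 0 (C * x) with h | h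
    · exact (Nat.floor_le h).trans (mul_le_mul_of_nonneg_right (le_max_left _ _) hx.le)
    · rw [Nat.floor_of_nonpos h.le, Nat.cast_zero]
      positivity
  apply Nat.le_floor
  push_cast
  calc (⌊C₁ * T ^ a⌋₊ : ℝ) * ⌊C₂ * T ^ κ⌋₊ ≤ (max C₁ 0 * T ^ a) * (max C₂ 0 * T ^ κ) :=
        mul_le_mul (bound C₁ _ ha) (bound C₂ _ hκ) (Nat.cast_nonneg _) (by positivity)
    _ = (max C₁ 0 * max C₂ 0) * T ^ (a + κ) := by
        rw [Real.rpow_add hT]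
        ring

/-- The exponent bookkeeping: `(M − k − 1) + κ < (M − k − 1)·k` when `κ < (M − k − 1)(k − 1)`. [folklore] -/
theorem exponent_lt {M k : ℕ} {κ : ℝ} (hκ : κ < ((M : ℝ) - k - 1) * ((k : ℝ) - 1)) :
    ((M : ℝ) - k - 1) + κ < ((M : ℝ) - k - 1) * k := by
  have e : ((M : ℝ) - k - 1) * ((k : ℝ) - 1) = ((M : ℝ) - k - 1) * k - ((M : ℝ) - k - 1) := by ring
  linarith

/-! ## The composition: the two stubs prove the crux BY NAME -/

/-- **Composition** (`stub₁ → stub₂ → CountingGapHigher`, sorry-free).  Given `k ≥ 2` and `b > 0`: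
`PerCellGap` supplies the width `M`, an exponent `κ < (M − k − 1)(k − 1)` and a uniform per-cell bound
`⌊C₂ T^κ⌋`; `UnitCellCluster` at that width bounds the number of cells met by `⌊C₁ T^(M−k−1)⌋`; fibre
counting over the cell map `w ↦ ⌊Re w⌋` gives `encard S_T ≤ ⌊C₁ T^(M−k−1)⌋ · ⌊C₂ T^κ⌋ ≤
⌊C₁⁺C₂⁺ · T^((M−k−1)+κ)⌋`, and `(M − k − 1) + κ < (M − k − 1)k` is the amplification threshold. [folklore] -/
theorem CountingGapHigher_of :
    (∀ k : ℕ, 2 ≤ k → ∀ b : ℝ, 0 < b → ∀ M : ℕ, k + 2 ≤ M → ∃ C : ℝ, ∀ᶠ T : ℝ in Filter.atTop,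
      ({n : Fin M → ℤ | ∃ w : Fin M → ℂ, ((∀ i, |(w i).re| ≤ T ∧ |(w i).im| ≤ b) ∧ (∃ f : Fin (k + 1) ↪ Fin M, LinearIndependent ℚ (w ∘ f)) ∧ ∃ (s : ℕ) (P : Fin s → MvPolynomial (Fin M ⊕ Fin M) ℤ) (e : Fin M ↪ Fin s), 2 * M ≤ s + k ∧ (∀ j, ((P j).totalDegree : ℝ) ≤ T ∧ ∀ mo, |(((P j).coeff mo : ℤ) : ℝ)| ≤ T) ∧ (∀ j, MvPolynomial.aeval (Sum.elim w (Complex.exp ∘ w)) (P j) = 0) ∧ LinearIndependent ℂ (fun j => fun i : Fin M ⊕ Fin M => MvPolynomial.aeval (Sum.elim w (Complex.exp ∘ w)) (MvPolynomial.pderiv i (P j))) ∧ (Matrix.of fun i j : Fin M => MvPolynomial.aeval (Sum.elim w (Complex.exp ∘ w)) (MvPolynomial.pderiv (Sum.inl j) (P (e i)) + MvPolynomial.X (Sum.inr j) * MvPolynomial.pderiv (Sum.inr j) (P (e i)))).det ≠ 0) ∧ ∀ i, ⌊(w i).re⌋ = n i}).encard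
        ≤ ((⌊C * T ^ ((M : ℝ) - k - 1)⌋₊ : ℕ) : ℕ∞)) →
    (∀ k : ℕ, 2 ≤ k → ∀ b : ℝ, 0 < b → ∃ M : ℕ, k + 2 ≤ M ∧ ∃ κ : ℝ, κ < ((M : ℝ) - k - 1) * ((k : ℝ) - 1) ∧
      ∃ C : ℝ, ∀ᶠ T : ℝ in Filter.atTop, ∀ n : Fin M → ℤ,
        ({w : Fin M → ℂ | ((∀ i, |(w i).re| ≤ T ∧ |(w i).im| ≤ b) ∧ (∃ f : Fin (k + 1) ↪ Fin M, LinearIndependent ℚ (w ∘ f)) ∧ ∃ (s : ℕ) (P : Fin s → MvPolynomial (Fin M ⊕ Fin M) ℤ) (e : Fin M ↪ Fin s), 2 * M ≤ s + k ∧ (∀ j, ((P j).totalDegree : ℝ) ≤ T ∧ ∀ mo, |(((P j).coeff mo : ℤ) : ℝ)| ≤ T) ∧ (∀ j, MvPolynomial.aeval (Sum.elim w (Complex.exp ∘ w)) (P j) = 0) ∧ LinearIndependent ℂ (fun j => fun i : Fin M ⊕ Fin M => MvPolynomial.aeval (Sum.elim w (Complex.exp ∘ w)) (MvPolynomial.pderiv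 i (P j))) ∧ (Matrix.of fun i j : Fin M => MvPolynomial.aeval (Sum.elim w (Complex.exp ∘ w)) (MvPolynomial.pderiv (Sum.inl j) (P (e i)) + MvPolynomial.X (Sum.inr j) * MvPolynomial.pderiv (Sum.inr j) (P (e i)))).det ≠ 0) ∧ ∀ i, ⌊(w i).re⌋ = n i}).encard
          ≤ ((⌊C * T ^ κ⌋₊ : ℕ) : ℕ∞)) →
    Summit.Schanuel.Schanuel.Theses.RelationCounting.CountingGapHigher := by
  intro h₁ h₂ k hk b hb
  obtain ⟨M, hM, κ, hκ, C₂, hC₂⟩ := h₂ k hk b hb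
  obtain ⟨C₁, hC₁⟩ := h₁ k hk b hb M hM
  refine ⟨M, hM, ((M : ℝ) - k - 1) + κ, exponent_lt hκ, max C₁ 0 * max C₂ 0, ?_⟩
  filter_upwards [hC₁, hC₂, Filter.eventually_gt_atTop (0 : ℝ)] with T hT₁ hT₂ hT
  -- fold the set literals into `counted k M b T`
  have hA : ({n : Fin M → ℤ | ∃ w ∈ counted k M b T, ∀ i, ⌊(w i).re⌋ = n i}).encard
      ≤ ((⌊C₁ * T ^ ((M : ℝ) - k - 1)⌋₊ : ℕ) : ℕ∞) := hT₁
  have hB : ∀ n : Fin M → ℤ, ({w ∈ counted k M b T | ∀ i, ⌊(w i).re⌋ = n i}).encard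
      ≤ ((⌊C₂ * T ^ κ⌋₊ : ℕ) : ℕ∞) := hT₂
  rw [← image_cellOf_eq] at hA
  have hB' : ∀ n : Fin M → ℤ, ({w ∈ counted k M b T | cellOf w = n}).encard
      ≤ ((⌊C₂ * T ^ κ⌋₊ : ℕ) : ℕ∞) := fun n => (fibre_cellOf_eq _ n) ▸ hB n
  have hmain := encard_le_mul_of_fibres (counted k M b T) cellOf _ _ hA hB'
  change (counted k M b T).encard ≤ _
  refine hmain.trans ?_
  exact_mod_cast floor_mul_floor_le (C₁ := C₁) (C₂ := C₂) (a := (M : ℝ) - k - 1) (κ := κ) hT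

/-- **THE SKELETON THEOREM.** The crux `RelationCounting.CountingGapHigher`, concluded BY NAME from the
two DECLARED stubs (the only `sorry`s of the file) through the sorry-free composition. [folklore] -/
theorem CountingGapHigher_proof :
    Summit.Schanuel.Schanuel.Theses.RelationCounting.CountingGapHigher :=
  CountingGapHigher_of stub_unitCellCluster stub_perCellGap

end Summit.Schanuel.Schanuel.Cruxes.CountingGapHigher.Birth

end
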